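import Literature.Analysis.FluidPDE.GaussianVortexFormDomain
import HarnessLib

/-!
# Poincaré inequality and weak gradients on the form domain `H¹(μ_λ)` of `L_λ`

Analysis/FluidPDE file (definitions + proved theorems, no named facts), continuing
`GaussianVortexFormDomain` towards the Lax–Milgram inversion of the linearised operator `L_λ` of
the asymmetric Burgers vortex problem (named fact `GallayMaekawa2016_thm41`, Gallay–Maekawa 2016,
Thm. 4.1) in `GaussianVortexLinearLamSolver`. Ground-state variables: `w = ρ_λ u`,
`ρ_λ⁻¹L_λρ_λ = Δ − b_λ·∇` (`GaussianVortexLinearLamGap`), `μ_λ = ρ_λ dx`.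

* `gaussLamOne` — the constant `1 ∈ L²(μ_λ)`; `inner_gaussLamOne_left`: `⟪1, f⟫ = ∫ f dμ_λ` is the
  mass functional;
* `norm_sq_gaussLamGraph_fst/snd`, `inner_gaussLamOne_gaussLamGraph_fst` — norms and mass of
  graphs of test functions as weighted integrals;
* `poincare_gaussLamFormDomain` — **Poincaré on `H¹(μ_λ)`**: for `U = (u, ∇u) ∈ H¹(μ_λ)`,
  `‖u‖² − c_λ⟪1, u⟫² ≤ (2/(1−λ))‖∇u‖²`, `c_λ = √(1−λ²)/(4π) = μ_λ(ℝ²)⁻¹`, the variance form of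
  `sq_integral_gaussLam_poincare` transported to the closure (both sides are continuous); on the
  mean-zero part, `‖u‖² ≤ (2/(1−λ))‖∇u‖²` (`norm_sq_fst_le_of_mem_gaussLamFormDomain`) — the
  spectral gap `(1−λ)/2` of `L_λ`;
* `gaussLamAdjointLp φ = Δφ − b_λ·∇φ ∈ L²(μ_λ)` and `inner_fst_gaussLamAdjointLp_eq` — **the
  second component of `U ∈ H¹(μ_λ)` is the weak `μ_λ`-gradient of the first**:
  `⟪u, Δφ − b_λ·∇φ⟫_{L²(μ_λ)} = −⟪∇u, ∇φ⟫_{L²(μ_λ;ℝ²)}` for every test `φ` (closure of the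
  Dirichlet-form identity `integral_adjointLam_mul_mul_expNegQuadLam`).

## References

* Th. Gallay, Y. Maekawa, *Existence and stability of viscous vortices*, arXiv:1610.08384, §4.1,
  (4.3)–(4.6). [GallayMaekawa2016]
* D. Bakry, I. Gentil, M. Ledoux, *Analysis and Geometry of Markov Diffusion Operators*,
  Prop. 4.1.1, §3.3.1. [folklore]
-/

open MeasureTheory Filter Set WithLp Metric
open scoped Real RealInnerProductSpace Topology InnerProductSpace ContDiff Laplacian

noncomputable section

namespace Literature.Analysis.FluidPDE

open Literature.Analysis.UnboundedOperators

variable {lam : ℝ}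

/-! ### Coordinates of the gradient; bounds for test functions -/

/-- `(∇f)ᵢ = ∂ᵢf` on `ℝ²`. [folklore] -/
theorem gradient_apply_eq_fderiv_fin_two (f : EuclideanSpace ℝ (Fin 2) → ℝ) (x : EuclideanSpace ℝ (Fin 2))
    (i : Fin 2) : gradient f x i = fderiv ℝ f x (EuclideanSpace.single i (1 : ℝ)) := by
  have h := InnerProductSpace.toDual_symm_apply (𝕜 := ℝ) (x := EuclideanSpace.single i (1 : ℝ))
    (y := fderiv ℝ f x)
  rw [← gradient, EuclideanSpace.inner_single_right] at h
  simpa using h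

/-- `⟪∇f, ∇g⟫ = ∂₀f ∂₀g + ∂₁f ∂₁g` on `ℝ²`. [folklore] -/
theorem inner_gradient_gradient_fin_two (f g : EuclideanSpace ℝ (Fin 2) → ℝ)
    (x : EuclideanSpace ℝ (Fin 2)) :
    ⟪gradient f x, gradient g x⟫ =
      fderiv ℝ f x (EuclideanSpace.single 0 1) * fderiv ℝ g x (EuclideanSpace.single 0 1) +
        fderiv ℝ f x (EuclideanSpace.single 1 1) * fderiv ℝ g x (EuclideanSpace.single 1 1) := by
  rw [PiLp.inner_apply]
  simp only [Fin.sum_univ_two, gradient_apply_eq_fderiv_fin_two]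
  simp [mul_comm]

/-- `‖∇f(x)‖ = ‖Df(x)‖`. [folklore] -/
theorem norm_gradient_eq_norm_fderiv_fin_two (f : EuclideanSpace ℝ (Fin 2) → ℝ) (x : EuclideanSpace ℝ (Fin 2)) :
    ‖gradient f x‖ = ‖fderiv ℝ f x‖ := by
  rw [gradient, LinearIsometryEquiv.norm_map]

namespace planarTestFunctions

variable (φ : planarTestFunctions)

/-- A test function is bounded. [folklore] -/
theorem exists_bound : ∃ C, ∀ x, ‖(φ : EuclideanSpace ℝ (Fin 2) → ℝ) x‖ ≤ C :=
  (planarTestFunctions.continuous φ).bounded_above_of_compact_support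
    (planarTestFunctions.hasCompactSupport φ)

/-- The derivative of a test function is bounded. [folklore] -/
theorem exists_bound_fderiv : ∃ C, ∀ x, ‖fderiv ℝ (φ : EuclideanSpace ℝ (Fin 2) → ℝ) x‖ ≤ C :=
  ((planarTestFunctions.contDiff φ).continuous_fderiv (by simp)).bounded_above_of_compact_support
    ((planarTestFunctions.hasCompactSupport φ).fderiv (𝕜 := ℝ))

/-- The second derivative of a test function is bounded. [folklore] -/
theorem exists_bound_fderiv_fderiv :
    ∃ C, ∀ x, ‖fderiv ℝ (fderiv ℝ (φ : EuclideanSpace ℝ (Fin 2) → ℝ)) x‖ ≤ C :=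
  (((planarTestFunctions.contDiff φ).fderiv_right (m := ∞) (by simp)).continuous_fderiv
    (by simp)).bounded_above_of_compact_support
    (((planarTestFunctions.hasCompactSupport φ).fderiv (𝕜 := ℝ)).fderiv (𝕜 := ℝ))

end planarTestFunctions

/-! ### The constant `1 ∈ L²(μ_λ)` and the mass functional -/

section One

variable (hlam : lam ∈ Set.Ico (0 : ℝ) 1)
include hlam

/-- **The constant function `1 ∈ L²(μ_λ)`** (`λ ∈ [0,1)`, finite measure). [folklore] -/
def gaussLamOne : Lp ℝ 2 (gaussLamMeasure lam) :=
  haveI := isFiniteMeasure_gaussLamMeasure hlam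
  (memLp_const (1 : ℝ)).toLp _

/-- `1 = 1` a.e. [folklore] -/
theorem gaussLamOne_ae_eq :
    (gaussLamOne hlam : EuclideanSpace ℝ (Fin 2) → ℝ) =ᵐ[gaussLamMeasure lam] fun _ => 1 := by
  haveI := isFiniteMeasure_gaussLamMeasure hlam
  exact MemLp.coeFn_toLp _

/-- `⟪1, f⟫ = ∫ f dμ_λ`: the mass functional is the inner product with `1`. [folklore] -/
theorem inner_gaussLamOne_left (f : Lp ℝ 2 (gaussLamMeasure lam)) :
    ⟪gaussLamOne hlam, f⟫ = ∫ x, f x ∂gaussLamMeasure lam := by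
  rw [L2.inner_def]
  refine integral_congr_ae ?_
  filter_upwards [gaussLamOne_ae_eq hlam] with x hx
  simp only [RCLike.inner_apply, conj_trivial, hx]
  ring

/-- `⟪1, φ⟫ = ∫ φ ρ_λ` for a test function. [folklore] -/
theorem inner_gaussLamOne_gaussLamGraph_fst (φ : planarTestFunctions) :
    ⟪gaussLamOne hlam, (gaussLamGraph lam φ).fst⟫ =
      ∫ x, (φ : EuclideanSpace ℝ (Fin 2) → ℝ) x *
        Real.exp (-((1 + lam) / 4 * x 0 ^ 2 + (1 - lam) / 4 * x 1 ^ 2)) := by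
  rw [inner_gaussLamOne_left, gaussLamGraph_fst,
    integral_congr_ae (MemLp.coeFn_toLp (memLp_planarTestFunction lam φ)), integral_gaussLamMeasure]

/-- `⟪1, 1⟫ = μ_λ(ℝ²) = ∫ ρ_λ > 0`. [folklore] -/
theorem inner_gaussLamOne_self :
    ⟪gaussLamOne hlam, gaussLamOne hlam⟫ =
      ∫ x : EuclideanSpace ℝ (Fin 2), Real.exp (-((1 + lam) / 4 * x 0 ^ 2 + (1 - lam) / 4 * x 1 ^ 2)) := by
  rw [inner_gaussLamOne_left, integral_congr_ae (gaussLamOne_ae_eq hlam), integral_gaussLamMeasure]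
  simp

/-- `⟪1, 1⟫ > 0`. [folklore] -/
theorem inner_gaussLamOne_self_pos : 0 < ⟪gaussLamOne hlam, gaussLamOne hlam⟫ := by
  rw [inner_gaussLamOne_self hlam]
  exact integral_exp_pos (integrable_expNegQuadLam hlam)

end One

/-! ### Norms of graphs of test functions -/

section GraphNorms

variable (lam)

/-- `‖φ‖²_{L²(μ_λ)} = ∫ φ² ρ_λ`. [folklore] -/
theorem norm_sq_gaussLamGraph_fst (φ : planarTestFunctions) :
    ‖(gaussLamGraph lam φ).fst‖ ^ 2 =
      ∫ x, (φ : EuclideanSpace ℝ (Fin 2) → ℝ) x ^ 2 *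
        Real.exp (-((1 + lam) / 4 * x 0 ^ 2 + (1 - lam) / 4 * x 1 ^ 2)) := by
  rw [← real_inner_self_eq_norm_sq, gaussLamGraph_fst, L2.inner_def, ← integral_gaussLamMeasure]
  refine integral_congr_ae ?_
  filter_upwards [MemLp.coeFn_toLp (memLp_planarTestFunction lam φ)] with x hx
  simp only [RCLike.inner_apply, conj_trivial, hx]
  ring

/-- `‖∇φ‖²_{L²(μ_λ;ℝ²)} = ∫ ‖Dφ‖² ρ_λ`. [folklore] -/
theorem norm_sq_gaussLamGraph_snd (φ : planarTestFunctions) :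
    ‖(gaussLamGraph lam φ).snd‖ ^ 2 =
      ∫ x, ‖fderiv ℝ (φ : EuclideanSpace ℝ (Fin 2) → ℝ) x‖ ^ 2 *
        Real.exp (-((1 + lam) / 4 * x 0 ^ 2 + (1 - lam) / 4 * x 1 ^ 2)) := by
  rw [← real_inner_self_eq_norm_sq, gaussLamGraph_snd, L2.inner_def, ← integral_gaussLamMeasure]
  refine integral_congr_ae ?_
  filter_upwards [MemLp.coeFn_toLp (memLp_gradient_planarTestFunction lam φ)] with x hx
  rw [hx, real_inner_self_eq_norm_sq, norm_gradient_eq_norm_fderiv_fin_two]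

/-- The anisotropic Dirichlet form is dominated by `(1−λ)⁻¹ ∫ ‖Dφ‖² ρ_λ` for `0 ≤ λ < 1`.
[folklore] -/
theorem integral_anisoForm_mul_expNegQuadLam_le {lam : ℝ} (hlam : lam ∈ Set.Ico (0 : ℝ) 1)
    {h : EuclideanSpace ℝ (Fin 2) → ℝ} (hh : ContDiff ℝ 1 h) {C₁ : ℝ}
    (h1 : ∀ z, ‖fderiv ℝ h z‖ ≤ C₁) :
    ∫ y : EuclideanSpace ℝ (Fin 2),
        ((1 + lam)⁻¹ * fderiv ℝ h y (EuclideanSpace.single 0 1) ^ 2 +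
          (1 - lam)⁻¹ * fderiv ℝ h y (EuclideanSpace.single 1 1) ^ 2) *
          Real.exp (-((1 + lam) / 4 * y 0 ^ 2 + (1 - lam) / 4 * y 1 ^ 2)) ≤
      (1 - lam)⁻¹ * ∫ y : EuclideanSpace ℝ (Fin 2), ‖fderiv ℝ h y‖ ^ 2 *
        Real.exp (-((1 + lam) / 4 * y 0 ^ 2 + (1 - lam) / 4 * y 1 ^ 2)) := by
  obtain ⟨hl0, hl1⟩ := hlam
  have hp : 0 < 1 + lam := by linarith
  have hq : 0 < 1 - lam := by linarith
  set ρ : EuclideanSpace ℝ (Fin 2) → ℝ := fun y =>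
    Real.exp (-((1 + lam) / 4 * y 0 ^ 2 + (1 - lam) / 4 * y 1 ^ 2)) with hρ
  have hρpos : ∀ y, 0 < ρ y := fun y => Real.exp_pos _
  have hρi : Integrable ρ := integrable_expNegQuadLam ⟨hl0, hl1⟩
  have hb1 : ∀ y i, ‖fderiv ℝ h y (EuclideanSpace.single i (1 : ℝ))‖ ≤ C₁ := fun y i => by
    refine ((fderiv ℝ h y).le_opNorm _).trans ?_
    have hns : ‖(EuclideanSpace.single i (1 : ℝ) : EuclideanSpace ℝ (Fin 2))‖ = 1 := by simp
    rw [hns, mul_one]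
    exact h1 y
  have hsq : ∀ y i, fderiv ℝ h y (EuclideanSpace.single i (1 : ℝ)) ^ 2 ≤ C₁ ^ 2 := fun y i => by
    rw [← sq_abs, ← Real.norm_eq_abs]
    exact pow_le_pow_left₀ (norm_nonneg _) (hb1 y i) 2
  have hcont : ∀ i, Continuous fun y => fderiv ℝ h y (EuclideanSpace.single i (1 : ℝ)) := fun i =>
    (hh.continuous_fderiv one_ne_zero).clm_apply continuous_const
  have iform : Integrable fun y : EuclideanSpace ℝ (Fin 2) =>
      ((1 + lam)⁻¹ * fderiv ℝ h y (EuclideanSpace.single 0 1) ^ 2 +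
        (1 - lam)⁻¹ * fderiv ℝ h y (EuclideanSpace.single 1 1) ^ 2) * ρ y := by
    refine hρi.bdd_mul (((continuous_const.mul ((hcont 0).pow 2)).add
      (continuous_const.mul ((hcont 1).pow 2))).aestronglyMeasurable)
      (Eventually.of_forall (fun y => (?_ :
        ‖(1 + lam)⁻¹ * fderiv ℝ h y (EuclideanSpace.single 0 1) ^ 2 +
          (1 - lam)⁻¹ * fderiv ℝ h y (EuclideanSpace.single 1 1) ^ 2‖ ≤
          (1 + lam)⁻¹ * C₁ ^ 2 + (1 - lam)⁻¹ * C₁ ^ 2)))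
    rw [Real.norm_of_nonneg (by positivity)]
    exact add_le_add (mul_le_mul_of_nonneg_left (hsq y 0) (by positivity))
      (mul_le_mul_of_nonneg_left (hsq y 1) (by positivity))
  have igrad : Integrable fun y => ‖fderiv ℝ h y‖ ^ 2 * ρ y :=
    hρi.bdd_mul ((hh.continuous_fderiv one_ne_zero).norm.pow 2).aestronglyMeasurable
      (Eventually.of_forall fun y => by
        rw [norm_pow, norm_norm]; exact pow_le_pow_left₀ (norm_nonneg _) (h1 y) 2)
  have hpt : ∀ y, ((1 + lam)⁻¹ * fderiv ℝ h y (EuclideanSpace.single 0 1) ^ 2 +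
        (1 - lam)⁻¹ * fderiv ℝ h y (EuclideanSpace.single 1 1) ^ 2) * ρ y ≤
      (1 - lam)⁻¹ * (‖fderiv ℝ h y‖ ^ 2 * ρ y) := by
    intro y
    have hsum : fderiv ℝ h y (EuclideanSpace.single 0 1) ^ 2 +
        fderiv ℝ h y (EuclideanSpace.single 1 1) ^ 2 = ‖fderiv ℝ h y‖ ^ 2 := by
      rw [← sum_sq_apply_orthonormalBasis (EuclideanSpace.basisFun (Fin 2) ℝ)]
      simp [Fin.sum_univ_two]
    rw [← hsum]
    have hinv : (1 + lam)⁻¹ ≤ (1 - lam)⁻¹ := by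
      rw [inv_le_inv₀ hp hq]; linarith
    have h0sq := sq_nonneg (fderiv ℝ h y (EuclideanSpace.single 0 1))
    have hkey := mul_le_mul_of_nonneg_right hinv (mul_nonneg h0sq (hρpos y).le)
    nlinarith [hkey, sq_nonneg (fderiv ℝ h y (EuclideanSpace.single 1 1)), (hρpos y).le]
  have hcmp := integral_mono iform (igrad.const_mul _) hpt
  rwa [integral_const_mul] at hcmp

end GraphNorms

/-! ### Poincaré on `H¹(μ_λ)` -/

section Poincare

variable (hlam : lam ∈ Set.Ico (0 : ℝ) 1)
include hlam

/-- **Poincaré inequality on the form domain `H¹(μ_λ)`**: for `U = (u, ∇u) ∈ H¹(μ_λ)`,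
`‖u‖² − c_λ ⟪1, u⟫² ≤ (2/(1−λ)) ‖∇u‖²` in `L²(μ_λ)`, `c_λ = √(1−λ²)/(4π) = (∫ρ_λ)⁻¹`: the
variance form of `sq_integral_gaussLam_poincare` on graphs of test functions, extended to the
closure (both sides are continuous). [folklore] -/
theorem poincare_gaussLamFormDomain
    {U : WithLp 2 (Lp ℝ 2 (gaussLamMeasure lam) ×
      Lp (EuclideanSpace ℝ (Fin 2)) 2 (gaussLamMeasure lam))}
    (hU : U ∈ gaussLamFormDomain lam) :
    ‖U.fst‖ ^ 2 - Real.sqrt (1 - lam ^ 2) / (4 * Real.pi) * ⟪gaussLamOne hlam, U.fst⟫ ^ 2 ≤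
      2 / (1 - lam) * ‖U.snd‖ ^ 2 := by
  obtain ⟨hl0, hl1⟩ := hlam
  have hq : 0 < 1 - lam := by linarith
  refine gaussLamFormDomain_induction lam
    (P := fun U => ‖U.fst‖ ^ 2 - Real.sqrt (1 - lam ^ 2) / (4 * Real.pi) *
      ⟪gaussLamOne ⟨hl0, hl1⟩, U.fst⟫ ^ 2 ≤ 2 / (1 - lam) * ‖U.snd‖ ^ 2) ?_ ?_ hU
  · have hc1 : Continuous fun U : WithLp 2 (Lp ℝ 2 (gaussLamMeasure lam) ×
        Lp (EuclideanSpace ℝ (Fin 2)) 2 (gaussLamMeasure lam)) => U.fst :=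
      WithLp.continuous_fst _ _ _
    have hc2 : Continuous fun U : WithLp 2 (Lp ℝ 2 (gaussLamMeasure lam) ×
        Lp (EuclideanSpace ℝ (Fin 2)) 2 (gaussLamMeasure lam)) => U.snd :=
      WithLp.continuous_snd _ _ _
    exact isClosed_le (((hc1.norm.pow 2).sub (continuous_const.mul
      ((continuous_const.inner hc1).pow 2)))) (continuous_const.mul (hc2.norm.pow 2))
  · intro φ
    set c : ℝ := Real.sqrt (1 - lam ^ 2) / (4 * Real.pi) with hc
    have hcpos : 0 < c := by
      have h : 0 < 1 - lam ^ 2 := by nlinarith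
      have := Real.sqrt_pos.2 h
      positivity
    obtain ⟨C₀, h0⟩ := planarTestFunctions.exists_bound φ
    obtain ⟨C₁, h1⟩ := planarTestFunctions.exists_bound_fderiv φ
    have hh : ContDiff ℝ 1 (φ : EuclideanSpace ℝ (Fin 2) → ℝ) :=
      (planarTestFunctions.contDiff φ).of_le (by simp)
    have hP := sq_integral_gaussLam_poincare (lam := lam) ⟨by linarith, hl1⟩ hh h0 h1
    have hA := integral_anisoForm_mul_expNegQuadLam_le ⟨hl0, hl1⟩ hh h1
    set ρ : EuclideanSpace ℝ (Fin 2) → ℝ := fun y =>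
      Real.exp (-((1 + lam) / 4 * y 0 ^ 2 + (1 - lam) / 4 * y 1 ^ 2)) with hρ
    -- pull the constant `c` out of the three integrals of `hP`
    have e1 : (fun y => (φ : EuclideanSpace ℝ (Fin 2) → ℝ) y ^ 2 * (c * ρ y)) =
        fun y => c * ((φ : EuclideanSpace ℝ (Fin 2) → ℝ) y ^ 2 * ρ y) := by funext y; ring
    have e2 : (fun y => (φ : EuclideanSpace ℝ (Fin 2) → ℝ) y * (c * ρ y)) =
        fun y => c * ((φ : EuclideanSpace ℝ (Fin 2) → ℝ) y * ρ y) := by funext y; ring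
    have e3 : (fun y : EuclideanSpace ℝ (Fin 2) =>
        ((1 + lam)⁻¹ * fderiv ℝ (φ : EuclideanSpace ℝ (Fin 2) → ℝ) y (EuclideanSpace.single 0 1) ^ 2 +
          (1 - lam)⁻¹ * fderiv ℝ (φ : EuclideanSpace ℝ (Fin 2) → ℝ) y
            (EuclideanSpace.single 1 1) ^ 2) * (c * ρ y)) =
        fun y => c * (((1 + lam)⁻¹ * fderiv ℝ (φ : EuclideanSpace ℝ (Fin 2) → ℝ) y
          (EuclideanSpace.single 0 1) ^ 2 +
          (1 - lam)⁻¹ * fderiv ℝ (φ : EuclideanSpace ℝ (Fin 2) → ℝ) y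
            (EuclideanSpace.single 1 1) ^ 2) * ρ y) := by
      funext y; ring
    rw [e1, e2, e3, integral_const_mul, integral_const_mul, integral_const_mul] at hP
    rw [norm_sq_gaussLamGraph_fst, norm_sq_gaussLamGraph_snd,
      inner_gaussLamOne_gaussLamGraph_fst ⟨hl0, hl1⟩]
    -- `hP : c X − (c m)² ≤ 2 c A`, `hA : A ≤ (1−λ)⁻¹ D`; want `X − c m² ≤ 2/(1−λ) D`
    have key : c * ((∫ y, (φ : EuclideanSpace ℝ (Fin 2) → ℝ) y ^ 2 * ρ y) -
        c * (∫ y, (φ : EuclideanSpace ℝ (Fin 2) → ℝ) y * ρ y) ^ 2) ≤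
        c * (2 / (1 - lam) * ∫ y, ‖fderiv ℝ (φ : EuclideanSpace ℝ (Fin 2) → ℝ) y‖ ^ 2 * ρ y) := by
      have h2c : 0 ≤ 2 * c := by positivity
      have := mul_le_mul_of_nonneg_left hA h2c
      rw [div_eq_mul_inv]
      nlinarith [this]
    exact le_of_mul_le_mul_left key hcpos

/-- **Poincaré on the mean-zero part of `H¹(μ_λ)`**: if `⟪1, u⟫ = 0` then
`‖u‖² ≤ (2/(1−λ)) ‖∇u‖²`. [folklore] -/
theorem norm_sq_fst_le_of_mem_gaussLamFormDomain
    {U : WithLp 2 (Lp ℝ 2 (gaussLamMeasure lam) ×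
      Lp (EuclideanSpace ℝ (Fin 2)) 2 (gaussLamMeasure lam))}
    (hU : U ∈ gaussLamFormDomain lam) (hmean : ⟪gaussLamOne hlam, U.fst⟫ = 0) :
    ‖U.fst‖ ^ 2 ≤ 2 / (1 - lam) * ‖U.snd‖ ^ 2 := by
  have := poincare_gaussLamFormDomain hlam hU
  rw [hmean] at this
  simpa using this

end Poincare

/-! ### The weak gradient: `∫ u (Δφ − b_λ·∇φ) dμ_λ = −⟪∇u, ∇φ⟫` on `H¹(μ_λ)` -/

section WeakGradient

variable (lam)

/-- The formal adjoint `Δφ − b_λ·∇φ` of the drift–diffusion operator applied to a test function,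
as an element of `L²(μ_λ)` (continuous with compact support). [folklore] -/
def gaussLamAdjointLp (φ : planarTestFunctions) : Lp ℝ 2 (gaussLamMeasure lam) :=
  (memLp_gaussLamMeasure_of_hasCompactSupport lam
    ((continuous_laplacian_fin_two (planarTestFunctions.contDiff φ)).sub
      (continuous_adjointDrift (planarTestFunctions.contDiff φ) lam))
    ((hasCompactSupport_laplacian_fin_two (planarTestFunctions.contDiff φ)
      (planarTestFunctions.hasCompactSupport φ)).sub
      (hasCompactSupport_adjointDrift (planarTestFunctions.hasCompactSupport φ) lam)) 2).toLp
    (fun x => Δ (φ : EuclideanSpace ℝ (Fin 2) → ℝ) x -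
      ((1 + lam) / 2 * x 0 * fderiv ℝ (φ : EuclideanSpace ℝ (Fin 2) → ℝ) x (EuclideanSpace.single 0 1) +
        (1 - lam) / 2 * x 1 * fderiv ℝ (φ : EuclideanSpace ℝ (Fin 2) → ℝ) x (EuclideanSpace.single 1 1)))

/-- `gaussLamAdjointLp φ = Δφ − b_λ·∇φ` a.e. [folklore] -/
theorem gaussLamAdjointLp_ae_eq (φ : planarTestFunctions) :
    (gaussLamAdjointLp lam φ : EuclideanSpace ℝ (Fin 2) → ℝ) =ᵐ[gaussLamMeasure lam]
      fun x => Δ (φ : EuclideanSpace ℝ (Fin 2) → ℝ) x -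
        ((1 + lam) / 2 * x 0 * fderiv ℝ (φ : EuclideanSpace ℝ (Fin 2) → ℝ) x
          (EuclideanSpace.single 0 1) +
          (1 - lam) / 2 * x 1 * fderiv ℝ (φ : EuclideanSpace ℝ (Fin 2) → ℝ) x
            (EuclideanSpace.single 1 1)) :=
  MemLp.coeFn_toLp _

/-- `⟪u, Δφ − b_λ·∇φ⟫_{L²(μ_λ)} = ∫ u (Δφ − b_λ·∇φ) ρ_λ dx`. [folklore] -/
theorem inner_gaussLamAdjointLp (u : Lp ℝ 2 (gaussLamMeasure lam)) (φ : planarTestFunctions) :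
    ⟪u, gaussLamAdjointLp lam φ⟫ =
      ∫ x, u x * (Δ (φ : EuclideanSpace ℝ (Fin 2) → ℝ) x -
        ((1 + lam) / 2 * x 0 * fderiv ℝ (φ : EuclideanSpace ℝ (Fin 2) → ℝ) x
          (EuclideanSpace.single 0 1) +
          (1 - lam) / 2 * x 1 * fderiv ℝ (φ : EuclideanSpace ℝ (Fin 2) → ℝ) x
            (EuclideanSpace.single 1 1))) *
        Real.exp (-((1 + lam) / 4 * x 0 ^ 2 + (1 - lam) / 4 * x 1 ^ 2)) := by
  rw [L2.inner_def, ← integral_gaussLamMeasure]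
  refine integral_congr_ae ?_
  filter_upwards [gaussLamAdjointLp_ae_eq lam φ] with x hx
  simp only [RCLike.inner_apply, conj_trivial, hx]
  ring

/-- `⟪G, ∇φ⟫_{L²(μ_λ;ℝ²)} = ∫ ⟪G, ∇φ⟫ ρ_λ dx`. [folklore] -/
theorem inner_gaussLamGraph_snd (G : Lp (EuclideanSpace ℝ (Fin 2)) 2 (gaussLamMeasure lam))
    (φ : planarTestFunctions) :
    ⟪G, (gaussLamGraph lam φ).snd⟫ =
      ∫ x, ⟪(G : EuclideanSpace ℝ (Fin 2) → EuclideanSpace ℝ (Fin 2)) x,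
          gradient (φ : EuclideanSpace ℝ (Fin 2) → ℝ) x⟫ *
        Real.exp (-((1 + lam) / 4 * x 0 ^ 2 + (1 - lam) / 4 * x 1 ^ 2)) := by
  rw [L2.inner_def, ← integral_gaussLamMeasure]
  refine integral_congr_ae ?_
  filter_upwards [MemLp.coeFn_toLp (memLp_gradient_planarTestFunction lam φ)] with x hx
  rw [gaussLamGraph_snd, hx]

/-- **The second component of `U ∈ H¹(μ_λ)` is the weak `μ_λ`-gradient of the first**, in the
form adapted to `L_λ`: for every test function `φ`,
`⟪u, Δφ − b_λ·∇φ⟫_{L²(μ_λ)} = −⟪∇u, ∇φ⟫_{L²(μ_λ;ℝ²)}`. On graphs of test functions this is the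
Dirichlet-form identity `integral_adjointLam_mul_mul_expNegQuadLam`; both sides are continuous
in `U`, so it persists on the closure. [folklore] -/
theorem inner_fst_gaussLamAdjointLp_eq {lam : ℝ} (hlam : lam ∈ Set.Ico (0 : ℝ) 1)
    {U : WithLp 2 (Lp ℝ 2 (gaussLamMeasure lam) ×
      Lp (EuclideanSpace ℝ (Fin 2)) 2 (gaussLamMeasure lam))}
    (hU : U ∈ gaussLamFormDomain lam) (φ : planarTestFunctions) :
    ⟪U.fst, gaussLamAdjointLp lam φ⟫ = -⟪U.snd, (gaussLamGraph lam φ).snd⟫ := by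
  refine gaussLamFormDomain_induction lam
    (P := fun U => ⟪U.fst, gaussLamAdjointLp lam φ⟫ = -⟪U.snd, (gaussLamGraph lam φ).snd⟫) ?_ ?_ hU
  · have hc1 : Continuous fun U : WithLp 2 (Lp ℝ 2 (gaussLamMeasure lam) ×
        Lp (EuclideanSpace ℝ (Fin 2)) 2 (gaussLamMeasure lam)) => U.fst :=
      WithLp.continuous_fst _ _ _
    have hc2 : Continuous fun U : WithLp 2 (Lp ℝ 2 (gaussLamMeasure lam) ×
        Lp (EuclideanSpace ℝ (Fin 2)) 2 (gaussLamMeasure lam)) => U.snd :=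
      WithLp.continuous_snd _ _ _
    exact isClosed_eq (hc1.inner continuous_const) (hc2.inner continuous_const).neg
  · intro ψ
    obtain ⟨C₁, hu1⟩ := planarTestFunctions.exists_bound_fderiv φ
    obtain ⟨C₂, hu2⟩ := planarTestFunctions.exists_bound_fderiv_fderiv φ
    obtain ⟨D₀, hv0⟩ := planarTestFunctions.exists_bound ψ
    obtain ⟨D₁, hv1⟩ := planarTestFunctions.exists_bound_fderiv ψ
    have key := integral_adjointLam_mul_mul_expNegQuadLam hlam
      ((planarTestFunctions.contDiff φ).of_le (by norm_cast))
      ((planarTestFunctions.contDiff ψ).of_le (by norm_cast)) hu1 hu2 hv0 hv1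
    rw [inner_gaussLamAdjointLp, inner_gaussLamGraph_snd, gaussLamGraph_fst, gaussLamGraph_snd]
    have hL : ∫ x, ((memLp_planarTestFunction lam ψ).toLp _ : EuclideanSpace ℝ (Fin 2) → ℝ) x *
        (Δ (φ : EuclideanSpace ℝ (Fin 2) → ℝ) x -
          ((1 + lam) / 2 * x 0 * fderiv ℝ (φ : EuclideanSpace ℝ (Fin 2) → ℝ) x
            (EuclideanSpace.single 0 1) +
            (1 - lam) / 2 * x 1 * fderiv ℝ (φ : EuclideanSpace ℝ (Fin 2) → ℝ) x
              (EuclideanSpace.single 1 1))) *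
        Real.exp (-((1 + lam) / 4 * x 0 ^ 2 + (1 - lam) / 4 * x 1 ^ 2)) =
        ∫ x, (Δ (φ : EuclideanSpace ℝ (Fin 2) → ℝ) x -
          ((1 + lam) / 2 * x 0 * fderiv ℝ (φ : EuclideanSpace ℝ (Fin 2) → ℝ) x
            (EuclideanSpace.single 0 1) +
            (1 - lam) / 2 * x 1 * fderiv ℝ (φ : EuclideanSpace ℝ (Fin 2) → ℝ) x
              (EuclideanSpace.single 1 1))) *
          (ψ : EuclideanSpace ℝ (Fin 2) → ℝ) x *
          Real.exp (-((1 + lam) / 4 * x 0 ^ 2 + (1 - lam) / 4 * x 1 ^ 2)) := by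
      refine integral_congr_ae ?_
      filter_upwards [(ae_gaussLamMeasure_iff lam).1
        (MemLp.coeFn_toLp (memLp_planarTestFunction lam ψ))] with x hx
      rw [hx]
      ring
    have hR : ∫ x, ⟪((memLp_gradient_planarTestFunction lam ψ).toLp _ :
          EuclideanSpace ℝ (Fin 2) → EuclideanSpace ℝ (Fin 2)) x,
          gradient (φ : EuclideanSpace ℝ (Fin 2) → ℝ) x⟫ *
        Real.exp (-((1 + lam) / 4 * x 0 ^ 2 + (1 - lam) / 4 * x 1 ^ 2)) =
        ∫ x, (fderiv ℝ (φ : EuclideanSpace ℝ (Fin 2) → ℝ) x (EuclideanSpace.single 0 1) *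
            fderiv ℝ (ψ : EuclideanSpace ℝ (Fin 2) → ℝ) x (EuclideanSpace.single 0 1) +
          fderiv ℝ (φ : EuclideanSpace ℝ (Fin 2) → ℝ) x (EuclideanSpace.single 1 1) *
            fderiv ℝ (ψ : EuclideanSpace ℝ (Fin 2) → ℝ) x (EuclideanSpace.single 1 1)) *
          Real.exp (-((1 + lam) / 4 * x 0 ^ 2 + (1 - lam) / 4 * x 1 ^ 2)) := by
      refine integral_congr_ae ?_
      filter_upwards [(ae_gaussLamMeasure_iff lam).1
        (MemLp.coeFn_toLp (memLp_gradient_planarTestFunction lam ψ))] with x hx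
      rw [hx, inner_gradient_gradient_fin_two]
      ring
    rw [hL, hR, key]

end WeakGradient

end Literature.Analysis.FluidPDE
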